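import Summits.NavierStokesRegularity.FunctionalMining.TopEigDanskin
import HarnessLib

/-!
# FunctionalMining — wells and flat twin walls are free pieces: the Rayleigh form `m(|f|² − 3 fᵀBf)`

Search for candidate a priori estimates; no regularity claim. Cell `pub-nsfunc`, prove seat
(gen 21). Kernel form of the EXAMPLES (i)–(ii) after F1 PART I Proposition 4 (= the exact, profile-free
form of SIEVELD (6) LEMMA W; pen, countersigned in the cell — not a cited fact). A tensor whose Rayleigh
form is

  `fᵀAf = m (|f|² − 3 [(1 − θ)(f·n₋)² + θ (f·n₊)²])`        (`A = m(𝟙 − 3B)`, `B = (1−θ) n₋⊗n₋ + θ n₊⊗n₊`)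

— a WELL for `θ ∈ {0, 1}`, a point of a FLAT TWIN WALL of profile value `θ` in general — has, for
`m ≥ 0` and `θ ∈ [0, 1]`: top Rayleigh value `λ(A) = m`, attained at every unit `e ⊥ n₋, n₊`
(`TopEig.lam_eq_of_twinWall`, `TopEig.mem_topEigSet_of_twinWall`): the constant vector
`e = n₊ × n₋ / |n₊ × n₋|` is a top vector ACROSS the wall whatever the profile `θ(x) ∈ [0,1]`, so by
Proposition 4 / 4′ (`TopEigSelectionBound`, `TopEigJensen`) such walls cost nothing, at any thickness
and after mollification. Conversely an OVERSHOOTING profile is not free: for `θ < 0`, `m > 0` and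
non-parallel unit `n₊, n₋`, `λ(A) > m` (`TopEig.lam_gt_of_overshoot`; test vector
`n₊ − (n₊·n₋) n₋`), so `e` is no longer a top vector. The matrix reading of the hypothesis is
`TopEig.quad_flat_well_twinWall`. Dimension-free. [ours; folklore linear algebra]
-/

noncomputable section

open Set
open scoped Matrix

namespace Summit.NavierStokesRegularity.FunctionalMining

namespace TopEig

variable {d : Type*} [Fintype d] [DecidableEq d] [Nonempty d]

/-! ## 1. The twin-wall Rayleigh form: `λ = m`, with the constant top vector `e ⊥ n₊, n₋` -/

/-- **Flat twin walls (and wells) are free: `λ(A) = m`.** If `fᵀAf = m(|f|² − 3[(1−θ)(f·n₋)² + θ(f·n₊)²])`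
for all `f`, with `m ≥ 0`, `0 ≤ θ ≤ 1`, and `e` is a unit vector orthogonal to `n₋` and `n₊`, then
`λ(A) = m`. [ours; F1 PART I §2 Example (ii)] -/
theorem lam_eq_of_twinWall {A : EuclideanSpace ℝ (d × d)} {m θ : ℝ} {nm np e : d → ℝ} (hm : 0 ≤ m)
    (hθ0 : 0 ≤ θ) (hθ1 : θ ≤ 1)
    (hA : ∀ f : d → ℝ, quad A f = m * (f ⬝ᵥ f - 3 * ((1 - θ) * (f ⬝ᵥ nm) ^ 2 + θ * (f ⬝ᵥ np) ^ 2)))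
    (he : e ∈ unitSphere d) (hem : e ⬝ᵥ nm = 0) (hep : e ⬝ᵥ np = 0) : lam A = m := by
  refine le_antisymm (lam_le fun f hf => ?_) ?_
  · rw [hA f, hf]
    have h1 : 0 ≤ (1 - θ) * (f ⬝ᵥ nm) ^ 2 + θ * (f ⬝ᵥ np) ^ 2 :=
      add_nonneg (mul_nonneg (by linarith) (sq_nonneg _)) (mul_nonneg hθ0 (sq_nonneg _))
    nlinarith
  · have h2 : quad A e = m := by rw [hA e, hem, hep, show e ⬝ᵥ e = 1 from he]; ring
    rw [← h2]
    exact quad_le_lam A he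

/-- … and the constant unit vector `e ⊥ n₋, n₊` is a top vector: `e ∈ E(A)`. [ours] -/
theorem mem_topEigSet_of_twinWall {A : EuclideanSpace ℝ (d × d)} {m θ : ℝ} {nm np e : d → ℝ}
    (hm : 0 ≤ m) (hθ0 : 0 ≤ θ) (hθ1 : θ ≤ 1)
    (hA : ∀ f : d → ℝ, quad A f = m * (f ⬝ᵥ f - 3 * ((1 - θ) * (f ⬝ᵥ nm) ^ 2 + θ * (f ⬝ᵥ np) ^ 2)))
    (he : e ∈ unitSphere d) (hem : e ⬝ᵥ nm = 0) (hep : e ⬝ᵥ np = 0) : e ∈ topEigSet A := by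
  refine ⟨he, ?_⟩
  rw [lam_eq_of_twinWall hm hθ0 hθ1 hA he hem hep, hA e, hem, hep, show e ⬝ᵥ e = 1 from he]
  ring

/-- **Wells are free**: if `fᵀAf = m(|f|² − 3(f·n)²)` (the biaxial matrix `m(𝟙 − 3n⊗n)`), `m ≥ 0`, then
every unit `e ⊥ n` is a top vector and `λ(A) = m`. [ours; F1 PART I §2 Example (i)] -/
theorem lam_eq_of_well {A : EuclideanSpace ℝ (d × d)} {m : ℝ} {n e : d → ℝ} (hm : 0 ≤ m)
    (hA : ∀ f : d → ℝ, quad A f = m * (f ⬝ᵥ f - 3 * (f ⬝ᵥ n) ^ 2)) (he : e ∈ unitSphere d)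
    (hen : e ⬝ᵥ n = 0) : lam A = m ∧ e ∈ topEigSet A := by
  have hA' : ∀ f : d → ℝ, quad A f =
      m * (f ⬝ᵥ f - 3 * ((1 - 0) * (f ⬝ᵥ n) ^ 2 + 0 * (f ⬝ᵥ n) ^ 2)) := fun f => by
    rw [hA f]; ring
  exact ⟨lam_eq_of_twinWall hm le_rfl zero_le_one hA' he hen hen,
    mem_topEigSet_of_twinWall hm le_rfl zero_le_one hA' he hen hen⟩

/-! ## 2. Overshooting profiles are not free -/

omit [DecidableEq d] [Nonempty d] in
/-- **An overshooting profile is not free**: with `θ < 0`, `m > 0`, unit `n₊, n₋` and `(n₊·n₋)² < 1`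
(non-parallel normals), the Rayleigh form `m(|f|² − 3[(1−θ)(f·n₋)² + θ(f·n₊)²])` has `λ(A) > m`
(test vector `n₊ − (n₊·n₋)n₋ ⊥ n₋`), so the transverse vector `e` of Example (ii) is no longer a top
vector. (`θ > 1` is the same statement with `n₊ ↔ n₋`, `θ ↦ 1 − θ`.) [ours; F1 PART I §2, after (ii)] -/
theorem lam_gt_of_overshoot {A : EuclideanSpace ℝ (d × d)} {m θ : ℝ} {nm np : d → ℝ} (hm : 0 < m)
    (hθ : θ < 0)
    (hA : ∀ f : d → ℝ, quad A f = m * (f ⬝ᵥ f - 3 * ((1 - θ) * (f ⬝ᵥ nm) ^ 2 + θ * (f ⬝ᵥ np) ^ 2)))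
    (hnm : nm ⬝ᵥ nm = 1) (hnp : np ⬝ᵥ np = 1) (hc : (np ⬝ᵥ nm) ^ 2 < 1) : m < lam A := by
  set c : ℝ := np ⬝ᵥ nm with hcdef
  set f : d → ℝ := np - c • nm with hf
  have hfm : f ⬝ᵥ nm = 0 := by
    rw [hf, sub_dotProduct, smul_dotProduct, hnm, smul_eq_mul, mul_one, sub_self]
  have hfp : f ⬝ᵥ np = 1 - c ^ 2 := by
    rw [hf, sub_dotProduct, smul_dotProduct, hnp, smul_eq_mul, dotProduct_comm nm np, ← hcdef]
    ring
  have hff : f ⬝ᵥ f = 1 - c ^ 2 := by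
    rw [hf, sub_dotProduct, dotProduct_sub, dotProduct_sub, smul_dotProduct, dotProduct_smul,
      dotProduct_smul, smul_dotProduct, hnp, hnm, dotProduct_comm nm np, ← hcdef]
    simp only [smul_eq_mul]
    ring
  have hq : quad A f = m * ((1 - c ^ 2) - 3 * θ * (1 - c ^ 2) ^ 2) := by
    rw [hA f, hfm, hfp, hff]; ring
  have h1 : quad A f ≤ lam A * (f ⬝ᵥ f) := quad_le_lam_mul A f
  rw [hq, hff] at h1
  have hpos : 0 < 1 - c ^ 2 := by linarith
  -- divide by `1 - c²`
  have h2 : m * (1 - 3 * θ * (1 - c ^ 2)) ≤ lam A := by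
    have h3 : m * ((1 - c ^ 2) - 3 * θ * (1 - c ^ 2) ^ 2) = m * (1 - 3 * θ * (1 - c ^ 2)) * (1 - c ^ 2) := by
      ring
    rw [h3] at h1
    exact le_of_mul_le_mul_right h1 hpos
  have h4 : 0 < -(3 * θ * (1 - c ^ 2)) := by nlinarith
  nlinarith

/-! ## 3. The matrix reading of the hypothesis -/

omit [DecidableEq d] [Nonempty d] in
/-- `fᵀ(a bᵀ)f = (f·a)(b·f)`. [folklore] -/
theorem dotProduct_vecMulVec_mulVec (a b f : d → ℝ) :
    f ⬝ᵥ (Matrix.vecMulVec a b *ᵥ f) = (f ⬝ᵥ a) * (b ⬝ᵥ f) := by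
  rw [dotProduct, dotProduct, dotProduct, Finset.sum_mul_sum]
  refine Finset.sum_congr rfl fun i _ => ?_
  rw [Matrix.mulVec, dotProduct, Finset.mul_sum]
  exact Finset.sum_congr rfl fun j _ => by rw [Matrix.vecMulVec_apply]; ring

omit [Nonempty d] in
/-- **The matrix reading**: for `M = m(𝟙 − 3[(1−θ) n₋n₋ᵀ + θ n₊n₊ᵀ])` the Rayleigh form of the flattened
tensor is `fᵀMf = m(|f|² − 3[(1−θ)(f·n₋)² + θ(f·n₊)²])`, the hypothesis of the theorems above.
[folklore] -/
theorem quad_flat_well_twinWall (m θ : ℝ) (nm np f : d → ℝ) :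
    quad (SharpClass.DirectorForm.flat (m • ((1 : Matrix d d ℝ) -
      (3 : ℝ) • ((1 - θ) • Matrix.vecMulVec nm nm + θ • Matrix.vecMulVec np np)))) f =
      m * (f ⬝ᵥ f - 3 * ((1 - θ) * (f ⬝ᵥ nm) ^ 2 + θ * (f ⬝ᵥ np) ^ 2)) := by
  rw [SharpClass.DirectorForm.quad_flat, Matrix.smul_mulVec, dotProduct_smul,
    Matrix.sub_mulVec, Matrix.one_mulVec, dotProduct_sub, Matrix.smul_mulVec, dotProduct_smul,
    Matrix.add_mulVec, dotProduct_add, Matrix.smul_mulVec, Matrix.smul_mulVec,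
    dotProduct_smul, dotProduct_smul, dotProduct_vecMulVec_mulVec, dotProduct_vecMulVec_mulVec,
    dotProduct_comm nm f, dotProduct_comm np f]
  simp only [smul_eq_mul]
  ring

end TopEig

end Summit.NavierStokesRegularity.FunctionalMining

end
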